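import Summits.ABC.ABC.Theses.IsogenyGlueCongruence
import Literature.NumberTheory.DiophantineGeometry.FaltingsHeightJInvariantProofs
import HarnessLib

/-!
# Route `IsogenyGlueCongruence`, support item `SemistableHeightPolyBound` (stmt-ABC-13918) —
# calibration in the currency of the Weil height of `j`

Silverman's Proposition 2.1 (1986; PROVED in the tree for the stable height,
`silverman1986_jHeight_faltingsHeight_holds` with `….stableFaltingsHeight_form`:
`C₁ ≤ h(j_E) − 12 h_F(E) ≤ 6 log(1 + h(j_E)) + C₂` with absolute constants) turns the item
`SemistableHeightPolyBound` (`h_F(E) ≤ c N_E²` for semistable `E/ℚ` in global minimal form) into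
an EQUIVALENT statement about the Weil height of the `j`-invariant:

* `semistableHeightPolyBound_iff_logHeight_j` — `SemistableHeightPolyBound ↔ ∃ C, h(j_E) ≤ C N_E²`
  for every semistable elliptic `E/ℚ` given by a global minimal model with `N_E ≠ 0`, where
  `h(j) = Height.logHeight₁ W.j = log max(|num j|, den j)` (Mathlib, `Rat.logHeight₁_eq_log_max`).

So the item is exactly "the naive modular height `h(j_E)` of a semistable `E/ℚ` is `O(N_E²)`",
a uniform exponential bound `max(|num j_E|, den j_E) ≤ exp(C N_E²)`; in print such bounds come
only from modularity (`h_F ≪ N log N`, Murty–Pasten 2013, Pasten 2024) or from Baker's method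
(effective Shafarevich). The elementary absorption `6 log(1 + x) ≤ x/2 + 61` is
`six_mul_log_one_add_le`.

## References

* [Silverman1986] J. H. Silverman, *Heights and elliptic curves*, Arithmetic Geometry
  (Cornell–Silverman eds.), Springer 1986, Prop. 2.1 (p. 257).
-/

noncomputable section

open scoped Classical

-- `Summit.<Summit>.<Problem>` is the mandated summit-side namespace (CONVENTIONS §2); for the
-- single-conjunct summit `ABC` the two coincide, so the duplicate `ABC.ABC` is deliberate.
set_option linter.dupNamespace false

namespace Summit.ABC.ABC.Theorems

open WeierstrassCurve NumberField Height
open Summit.ABC.ABC.Theses.IsogenyGlueCongruence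
open Literature.NumberTheory.DiophantineGeometry

/-- **`6 log(1 + x) ≤ x/2 + 61` for `x ≥ 0`** (`log y ≤ y − 1` at `y = (1 + x)/12` and at
`y = 12`; the constant is crude on purpose). [folklore] -/
theorem six_mul_log_one_add_le {x : ℝ} (hx : 0 ≤ x) : 6 * Real.log (1 + x) ≤ x / 2 + 61 := by
  have h1 : 0 < 1 + x := by linarith
  have h2 := Real.log_le_sub_one_of_pos (show (0 : ℝ) < (1 + x) / 12 by positivity)
  have h12 := Real.log_le_sub_one_of_pos (show (0 : ℝ) < 12 by norm_num)
  rw [Real.log_div h1.ne' (by norm_num)] at h2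
  linarith

/-- **Silverman's Prop. 2.1 over `ℚ`, stable form**: there are absolute constants `C₁, C₂` with
`C₁ ≤ h(j) − 12 h_F ≤ 6 log(1 + h(j)) + C₂` for every elliptic `W/ℚ`, `h(j) = logHeight₁ W.j`
(the number-field statement `silverman1986_jHeight_faltingsHeight_holds.stableFaltingsHeight_form`
at `K = ℚ`, `[ℚ:ℚ] = 1`). [cite: Silverman1986, Prop. 2.1] -/
theorem exists_jHeight_sub_stableFaltingsHeight_bounds_rat :
    ∃ C₁ C₂ : ℝ, ∀ (W : WeierstrassCurve ℚ) [W.IsElliptic],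
      C₁ ≤ logHeight₁ W.j - 12 * W.stableFaltingsHeight ∧
      logHeight₁ W.j - 12 * W.stableFaltingsHeight ≤ 6 * Real.log (1 + logHeight₁ W.j) + C₂ := by
  obtain ⟨C₁, C₂, hC⟩ := silverman1986_jHeight_faltingsHeight_holds.stableFaltingsHeight_form
  refine ⟨C₁, C₂, fun W _ => ?_⟩
  have h := hC ℚ W
  rw [Module.finrank_self, Nat.cast_one, inv_one, one_mul] at h
  exact h

/-- **The item in the currency of `h(j)`.** `SemistableHeightPolyBound` (`∃ c, h_F(E) ≤ c N_E²`
for every semistable elliptic `E/ℚ` in global minimal form `W`, `N_E = W.conductorNorm ℤ ≠ 0`) is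
EQUIVALENT to `∃ C, h(j_E) ≤ C N_E²` over the same curves, `h(j) = Height.logHeight₁ W.j`
(`= log max(|num j|, den j)`, Mathlib `Rat.logHeight₁_eq_log_max`). `→`: Silverman's upper
inequality `h(j) ≤ 12 h_F + 6 log(1 + h(j)) + C₂` with `6 log(1 + h(j)) ≤ h(j)/2 + 61`
(`six_mul_log_one_add_le`) gives `h(j) ≤ 24 c N² + 2(61 + C₂)`; `←`: the lower inequality
`12 h_F ≤ h(j) − C₁`; in both directions the constant is absorbed by `N² ≥ 1`.
[cite: Silverman1986, Prop. 2.1] -/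
theorem semistableHeightPolyBound_iff_logHeight_j :
    SemistableHeightPolyBound ↔
      ∃ C : ℝ, ∀ (W : WeierstrassCurve ℚ) [W.IsElliptic] [W.IsGloballyMinimal]
        [NeZero (W.conductorNorm ℤ)], W.IsSemistable ℤ →
          logHeight₁ W.j ≤ C * (W.conductorNorm ℤ : ℝ) ^ 2 := by
  obtain ⟨C₁, C₂, hC⟩ := exists_jHeight_sub_stableFaltingsHeight_bounds_rat
  have hN : ∀ (W : WeierstrassCurve ℚ) [NeZero (W.conductorNorm ℤ)],
      (1 : ℝ) ≤ (W.conductorNorm ℤ : ℝ) ^ 2 := by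
    intro W _
    have hN1 : (1 : ℝ) ≤ (W.conductorNorm ℤ : ℝ) := by
      exact_mod_cast Nat.one_le_iff_ne_zero.2 (NeZero.ne _)
    nlinarith
  unfold SemistableHeightPolyBound
  constructor
  · rintro ⟨c, hc⟩
    refine ⟨24 * c + 2 * max (61 + C₂) 0, fun W _ _ _ hss => ?_⟩
    have h1 := (hC W).2
    have h2 := hc W hss
    have h3 := six_mul_log_one_add_le (zero_le_logHeight₁ W.j)
    have h4 : 61 + C₂ ≤ max (61 + C₂) 0 * (W.conductorNorm ℤ : ℝ) ^ 2 :=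
      (le_max_left _ 0).trans (le_mul_of_one_le_right (le_max_right _ 0) (hN W))
    nlinarith
  · rintro ⟨C, hCj⟩
    refine ⟨(C + max (-C₁) 0) / 12, fun W _ _ _ hss => ?_⟩
    have h1 := (hC W).1
    have h2 := hCj W hss
    have h4 : -C₁ ≤ max (-C₁) 0 * (W.conductorNorm ℤ : ℝ) ^ 2 :=
      (le_max_left _ 0).trans (le_mul_of_one_le_right (le_max_right _ 0) (hN W))
    nlinarith

end Summit.ABC.ABC.Theorems

end
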